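import Summits.AtomisticToContinuum.Crystallization.Theorems.PeriodCoherenceLadderSparseTransferWindows

/-!
# Route `PeriodCoherenceLadder`, residual crux `MesoscopicCoarsePeriods`: the TRANSFER «costs ⇒ sparse bad balls», part 2 (the hull point)

Third reduction file of the line beneath the residual crux (after `…CleanRegions`, `…CleanWindows`).  It proves
the finite-`N`-to-hull transfer of the skeleton «frustration is paid for»: if

* (FSC, the new Lennard-Jones inequality, kept as a HYPOTHESIS) for every clearance `r₀ > 0` there are constants
  `0 < δ ≤ 7/10`, `b`, `κ > 0`, `C` with `κ · #{frustrated particles} ≤ (E(N) − N·e*) + C · #{r₀-exposed particles}`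
  in every `N`-particle ground state — a particle is *frustrated* when the ball of radius `4b + 2r₀ + 3` around it
  carries no local coarse period `t` (`δ ≤ ‖t‖ ≤ b`, precision `δ/4`, two-sided), *exposed* when a hole of
  clearance `r₀` lies within `4b + 2r₀ + 4` of it;
* (ESC = `SurfaceTensionNoFoam.ExposedSitesCost`, existing crux stmt-AtomisticToContinuum-13448, HYPOTHESIS, text
  verbatim) exposed particles cost energy;
* (CEL = `SurfaceTensionNoFoam.CrysEnergyLimit`, PROVED in the tree — `CrysEnergyLimit_holds`; hypothesis here only
  to keep this file inside the route's own import cone) `E(N)/N → e*`;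
* (SEP = uniform separation `7/10`, LANDED — `Theorems.LjLaminarWindowsSketch.lennardJones_groundState_dist_ge_seven_tenths`;
  hypothesis here for the same reason);

then along any sequence of ground states some Delone hull point has NO bad ball at all — in particular the
sparse-bad-balls hypothesis of `…CleanWindows.cleanWindows_of_sparse` holds, and with the two landed reductions the
crux `MesoscopicCoarsePeriods` follows (`mesoscopicCoarsePeriods_of_costs`).

Proof: counting (frustrated + exposed particles are `≤ K · (E(N) − N e*) = o(N)`; a `7/10`-separated set has at
most `m(ρ)` points in a ball of radius `ρ`, by a finite cover with balls of radius `7/20`), so for every `k` and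
all large `N` some particle has no bad particle within `k + r₀`; re-centred windows; local-matching compactness
(`PeriodPrecisionLadderExactPeriodFromFine.exists_subseq_forall_eventually_match`); density of the limit from the
absence of exposed particles (intermediate value theorem for the clearance along a segment); local coarse periods of
the limit from the non-frustrated particles (Bolzano–Weierstrass for the periods, attained infimum `δ/4`).
-/

noncomputable section

namespace Summit.AtomisticToContinuum.Crystallization.Theorems

namespace PeriodCoherenceLadderSparseTransfer

open Literature.MathematicalPhysics.StatisticalMechanics
open Filter Topology Metric
open Summit.AtomisticToContinuum.Crystallization.Theorems.PeriodPrecisionLadderExactPeriodFromFine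

/-- **No bad balls from costs** (development form: the excess `a N`, the constants and the two cost inequalities
are explicit hypotheses about the fixed sequence `x`).  Conclusion: a `δ`-separated, `(r₀+1)`-dense hull point of
`x` in which EVERY ball of radius `4b + 1` carries a local coarse period. -/
theorem noBadBalls_of_costs (x : (N : ℕ) → (Fin N → EuclideanSpace ℝ (Fin 3)))
    (hsep : ∀ (N : ℕ) (i j : Fin N), i ≠ j → (7 : ℝ) / 10 ≤ dist (x N i) (x N j))
    (a : ℕ → ℝ) (hlim : Tendsto (fun N : ℕ => a N / N) atTop (nhds 0))
    (r₀ δ b κ C c₀ R' : ℝ) (hr₀ : 0 < r₀) (hδ : 0 < δ) (hδ7 : δ ≤ 7 / 10) (hκ : 0 < κ) (hc₀ : 0 < c₀)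
    (hR'1 : 4 * b + 2 * r₀ + 4 ≤ R') (hR'2 : r₀ ≤ R')
    (hF : ∀ N : ℕ, κ * (Nat.card {i : Fin N // ¬ ∃ t : EuclideanSpace ℝ (Fin 3), δ ≤ ‖t‖ ∧ ‖t‖ ≤ b ∧ ∀ j : Fin N, dist (x N j) (x N i) ≤ 4 * b + 2 * r₀ + 3 → (∃ k : Fin N, dist (x N j + t) (x N k) ≤ δ / 4) ∧ (∃ k : Fin N, dist (x N j - t) (x N k) ≤ δ / 4)} : ℝ) ≤ a N + C * (Nat.card {i : Fin N // ∃ p : EuclideanSpace ℝ (Fin 3), dist p (x N i) ≤ 4 * b + 2 * r₀ + 4 ∧ ∀ j : Fin N, r₀ ≤ dist p (x N j)} : ℝ))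
    (hE : ∀ N : ℕ, c₀ * (Nat.card {i : Fin N // ∃ p : EuclideanSpace ℝ (Fin 3), dist p (x N i) ≤ R' ∧ ∀ j : Fin N, r₀ ≤ dist p (x N j)} : ℝ) ≤ a N) :
    ∃ X : Set (EuclideanSpace ℝ (Fin 3)), (∀ p ∈ X, ∀ q ∈ X, p ≠ q → δ ≤ dist p q) ∧
      (∀ c : EuclideanSpace ℝ (Fin 3), ∃ p ∈ X, dist p c ≤ r₀ + 1) ∧
      (∀ R ε : ℝ, 0 < ε → ∃ᶠ N in Filter.atTop, ∃ t : EuclideanSpace ℝ (Fin 3), (∀ p ∈ X, ‖p‖ ≤ R → ∃ i : Fin N, dist (x N i + t) p ≤ ε) ∧ (∀ i : Fin N, ‖x N i + t‖ ≤ R → ∃ p ∈ X, dist (x N i + t) p ≤ ε)) ∧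
      ∀ c : EuclideanSpace ℝ (Fin 3), ∃ t : EuclideanSpace ℝ (Fin 3), δ ≤ ‖t‖ ∧ ‖t‖ ≤ b ∧ ∀ p ∈ X, dist p c ≤ 4 * b + 1 → (∃ q ∈ X, dist (p + t) q ≤ δ / 4) ∧ (∃ q ∈ X, dist (p - t) q ≤ δ / 4) := by
  classical
  have hwin := exists_clear_window x hsep a hlim r₀ δ b κ C c₀ R' hδ hδ7 hκ hc₀ hR'1 hF hE
  have hinj : ∀ N, Function.Injective (x N) := fun N i j hij => by
    by_contra hne
    have h1 := hsep N i j hne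
    rw [hij, dist_self] at h1
    linarith
  -- names for the three particle predicates
  set FR : (N : ℕ) → Fin N → Prop := fun N i => ¬ ∃ t : EuclideanSpace ℝ (Fin 3), δ ≤ ‖t‖ ∧ ‖t‖ ≤ b ∧ ∀ j : Fin N, dist (x N j) (x N i) ≤ 4 * b + 2 * r₀ + 3 → (∃ k : Fin N, dist (x N j + t) (x N k) ≤ δ / 4) ∧ (∃ k : Fin N, dist (x N j - t) (x N k) ≤ δ / 4) with hFR
  set EX : (N : ℕ) → Fin N → Prop := fun N i => ∃ p : EuclideanSpace ℝ (Fin 3), dist p (x N i) ≤ 4 * b + 2 * r₀ + 4 ∧ ∀ j : Fin N, r₀ ≤ dist p (x N j) with hEX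
  set EX' : (N : ℕ) → Fin N → Prop := fun N i => ∃ p : EuclideanSpace ℝ (Fin 3), dist p (x N i) ≤ R' ∧ ∀ j : Fin N, r₀ ≤ dist p (x N j) with hEX'
  choose n hn using hwin
  -- Step 2: a strictly increasing selection N k ≥ n k, N k ≥ k
  let Nk : ℕ → ℕ := fun k => (∑ j ∈ Finset.range (k + 1), n j) + k
  have hNk_ge : ∀ k, n k ≤ Nk k := fun k => by
    have : n k ≤ ∑ j ∈ Finset.range (k + 1), n j :=
      Finset.single_le_sum (fun j _ => Nat.zero_le (n j)) (Finset.self_mem_range_succ k)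
    simp only [Nk]; omega
  have hNk_id : ∀ k, k ≤ Nk k := fun k => by simp only [Nk]; omega
  have hNk_mono : StrictMono Nk := by
    refine strictMono_nat_of_lt_succ fun k => ?_
    simp only [Nk, Finset.sum_range_succ _ (k + 1)]
    omega
  have hz : ∀ k, ∃ z : Fin (Nk k), ∀ i : Fin (Nk k), dist (x (Nk k) i) (x (Nk k) z) ≤ (k : ℝ) + r₀ →
      ¬ (FR (Nk k) i ∨ EX' (Nk k) i) := fun k => hn k (Nk k) (hNk_ge k)
  choose z hzw using hz
  -- Step 3: re-centred windows and local-matching compactness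
  let Ys : ℕ → Set (EuclideanSpace ℝ (Fin 3)) := fun k => Set.range fun i : Fin (Nk k) => x (Nk k) i - x (Nk k) (z k)
  have hYs_sep : ∀ k, ∀ p ∈ Ys k, ∀ q ∈ Ys k, p ≠ q → (7 : ℝ) / 10 ≤ dist p q := by
    intro k p hp q hq hpq
    obtain ⟨i, rfl⟩ := hp
    obtain ⟨j, rfl⟩ := hq
    rw [dist_sub_right]
    exact hsep _ i j fun h => hpq (by simp [h])
  obtain ⟨φ, Y, hφ, hYsep7, hmatch⟩ := exists_subseq_forall_eventually_match (by norm_num : (0 : ℝ) < 7 / 10) Ys hYs_sep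
  have hYsep : ∀ p ∈ Y, ∀ q ∈ Y, p ≠ q → δ ≤ dist p q := fun p hp q hq hpq => hδ7.trans (hYsep7 p hp q hq hpq)
  -- Step 4: finite density of the windows (no exposed particle ⇒ no hole of clearance r₀), via the IVT
  have hFD : ∀ (k : ℕ) (c' : EuclideanSpace ℝ (Fin 3)), ‖c'‖ ≤ (k : ℝ) → ∃ a' ∈ Ys k, dist a' c' < r₀ := by
    intro k c' hc'
    by_contra hcon
    push Not at hcon
    set N := Nk k with hNdef
    set c₁ : EuclideanSpace ℝ (Fin 3) := c' + x N (z k) with hc₁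
    have hfar : ∀ i : Fin N, r₀ ≤ dist (x N i) c₁ := by
      intro i
      have h1 := hcon (x N i - x N (z k)) ⟨i, rfl⟩
      have h2 : dist (x N i - x N (z k)) c' = dist (x N i) c₁ := by
        rw [dist_eq_norm, dist_eq_norm, hc₁]; congr 1; abel
      rwa [h2] at h1
    set S : Set (EuclideanSpace ℝ (Fin 3)) := Set.range (x N) with hS
    have hSne : S.Nonempty := ⟨x N (z k), Set.mem_range_self _⟩
    have hSc : IsCompact S := (Set.finite_range (x N)).isCompact
    set f : ℝ → ℝ := fun s => infDist (c₁ + s • (x N (z k) - c₁)) S with hf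
    have hfc : Continuous f :=
      (continuous_infDist_pt S).comp (continuous_const.add (continuous_id.smul continuous_const))
    have hf0 : r₀ ≤ f 0 := by
      simp only [hf, zero_smul, add_zero]
      rw [le_infDist hSne]
      rintro q ⟨i, rfl⟩
      rw [dist_comm]; exact hfar i
    have hf1 : f 1 = 0 := by
      simp only [hf, one_smul, add_sub_cancel]
      exact infDist_zero_of_mem (Set.mem_range_self _)
    have hIVT := intermediate_value_Icc' (zero_le_one' ℝ) hfc.continuousOn
    obtain ⟨s, hs, hfs⟩ := hIVT ⟨by rw [hf1]; exact hr₀.le, hf0⟩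
    set p : EuclideanSpace ℝ (Fin 3) := c₁ + s • (x N (z k) - c₁) with hp
    obtain ⟨q, hqS, hq⟩ := hSc.exists_infDist_eq_dist hSne p
    obtain ⟨i, rfl⟩ := hqS
    have hpi : dist p (x N i) = r₀ := by rw [← hq]; exact hfs
    have hEXi : EX' N i := by
      refine ⟨p, by rw [hpi]; exact hR'2, fun j => ?_⟩
      have h3 : infDist p S = r₀ := hfs
      have := infDist_le_dist_of_mem (Set.mem_range_self j : x N j ∈ S) (x := p)
      rw [h3] at this
      exact this
    have hps : dist p (x N (z k)) ≤ (k : ℝ) := by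
      have h1 : p - x N (z k) = (1 - s) • (c₁ - x N (z k)) := by
        rw [hp]; module
      rw [dist_eq_norm, h1, norm_smul, Real.norm_eq_abs, abs_of_nonneg (by linarith [hs.2])]
      have h2 : ‖c₁ - x N (z k)‖ = ‖c'‖ := by rw [hc₁]; simp
      rw [h2]
      calc (1 - s) * ‖c'‖ ≤ 1 * ‖c'‖ := mul_le_mul_of_nonneg_right (by linarith [hs.1]) (norm_nonneg _)
        _ ≤ k := by rw [one_mul]; exact hc'
    have hwin_i : dist (x N i) (x N (z k)) ≤ (k : ℝ) + r₀ := by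
      calc dist (x N i) (x N (z k)) ≤ dist (x N i) p + dist p (x N (z k)) := dist_triangle _ _ _
        _ ≤ r₀ + k := add_le_add (by rw [dist_comm, hpi]) hps
        _ = k + r₀ := add_comm _ _
    exact hzw k i hwin_i (Or.inr hEXi)
  -- window radius escapes along φ
  have hφge : ∀ k : ℕ, (k : ℝ) ≤ ((φ k : ℕ) : ℝ) := fun k => by exact_mod_cast hφ.id_le k
  -- Step 5: Y is (r₀ + 1)-dense
  have hYden : ∀ c : EuclideanSpace ℝ (Fin 3), ∃ p ∈ Y, dist p c ≤ r₀ + 1 := by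
    intro c
    obtain ⟨m₀, hm₀⟩ := exists_nat_ge ‖c‖
    obtain ⟨k, hk, hkm⟩ := ((hmatch (‖c‖ + r₀) 1 one_pos).and (eventually_ge_atTop m₀)).exists
    have hck : ‖c‖ ≤ ((φ k : ℕ) : ℝ) := hm₀.trans ((show (m₀ : ℝ) ≤ k by exact_mod_cast hkm).trans (hφge k))
    obtain ⟨a', ha', hac⟩ := hFD (φ k) c hck
    have han : ‖a'‖ ≤ ‖c‖ + r₀ := by
      have h1 : ‖a'‖ ≤ ‖c‖ + dist a' c := by
        have := norm_le_norm_add_norm_sub' a' c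
        rwa [← dist_eq_norm] at this
      linarith
    obtain ⟨s, hs, has⟩ := hk.2 a' ha' han
    refine ⟨s, hs, ?_⟩
    calc dist s c ≤ dist a' s + dist a' c := dist_triangle_left _ _ _
      _ ≤ 1 + r₀ := add_le_add has hac.le
      _ = r₀ + 1 := add_comm _ _
  -- Step 6: Y is a hull point of x
  have hYhull : ∀ R ε : ℝ, 0 < ε → ∃ᶠ N in Filter.atTop, ∃ t : EuclideanSpace ℝ (Fin 3),
      (∀ p ∈ Y, ‖p‖ ≤ R → ∃ i : Fin N, dist (x N i + t) p ≤ ε) ∧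
      (∀ i : Fin N, ‖x N i + t‖ ≤ R → ∃ p ∈ Y, dist (x N i + t) p ≤ ε) := by
    intro R ε hε
    rw [frequently_atTop]
    intro M
    obtain ⟨k, hk, hkM⟩ := ((hmatch R ε hε).and (eventually_ge_atTop M)).exists
    refine ⟨Nk (φ k), hkM.trans ((hφ.id_le k).trans (hNk_id (φ k))), -x (Nk (φ k)) (z (φ k)), ?_, ?_⟩
    · intro p hp hpR
      obtain ⟨a', ha', hap⟩ := hk.1 p hp hpR
      obtain ⟨i, rfl⟩ := ha'
      exact ⟨i, by rwa [← sub_eq_add_neg]⟩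
    · intro i hi
      rw [← sub_eq_add_neg] at hi ⊢
      exact hk.2 _ ⟨i, rfl⟩ hi
  -- (uniform discreteness) an infimum of distances to Y that is ≤ δ/4 + η for every η > 0 is attained ≤ δ/4
  have hattain : ∀ w : EuclideanSpace ℝ (Fin 3),
      (∀ η : ℝ, 0 < η → ∃ y' ∈ Y, dist w y' ≤ δ / 4 + η) → ∃ y' ∈ Y, dist w y' ≤ δ / 4 := by
    intro w hw
    by_contra hcon
    push Not at hcon
    have hfin : (Y ∩ closedBall w (δ / 4 + 1)).Finite :=
      finite_of_forall_le_dist_of_subset_closedBall hδ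
        (fun p hp q hq hpq => hYsep p hp.1 q hq.1 hpq) Set.inter_subset_right
    obtain ⟨y₁, hy₁, hd₁⟩ := hw 1 one_pos
    have hne : hfin.toFinset.Nonempty := by
      refine ⟨y₁, ?_⟩
      rw [Set.Finite.mem_toFinset]
      exact ⟨hy₁, by rw [mem_closedBall, dist_comm]; exact hd₁⟩
    obtain ⟨y₀, hy₀F, hmin⟩ := hfin.toFinset.exists_min_image (fun y => dist w y) hne
    rw [Set.Finite.mem_toFinset] at hy₀F
    have hgap : δ / 4 < dist w y₀ := hcon y₀ hy₀F.1
    obtain ⟨y₂, hy₂, hd₂⟩ := hw (min ((dist w y₀ - δ / 4) / 2) 1) (lt_min (by linarith) one_pos)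
    have hy₂F : y₂ ∈ hfin.toFinset := by
      rw [Set.Finite.mem_toFinset]
      refine ⟨hy₂, ?_⟩
      rw [mem_closedBall, dist_comm]
      exact hd₂.trans (by linarith [min_le_right ((dist w y₀ - δ / 4) / 2) (1 : ℝ)])
    have h1 := hmin y₂ hy₂F
    have h2 := min_le_left ((dist w y₀ - δ / 4) / 2) (1 : ℝ)
    have h3 : dist w y₀ ≤ δ / 4 + (dist w y₀ - δ / 4) / 2 := h1.trans (hd₂.trans (by linarith))
    linarith
  refine ⟨Y, hYsep, hYden, hYhull, fun c => ?_⟩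
  -- Step 7: local coarse periods of Y at every centre c
  -- local data at c along the subsequence: a particle of the window near c and its local coarse period
  have hloc : ∀ k : ℕ, ‖c‖ + r₀ ≤ ((φ k : ℕ) : ℝ) → ∃ a' ∈ Ys (φ k), dist a' c < r₀ ∧
      ∃ t : EuclideanSpace ℝ (Fin 3), δ ≤ ‖t‖ ∧ ‖t‖ ≤ b ∧ ∀ p' ∈ Ys (φ k), dist p' a' ≤ 4 * b + 2 * r₀ + 3 →
        (∃ q ∈ Ys (φ k), dist (p' + t) q ≤ δ / 4) ∧ (∃ q ∈ Ys (φ k), dist (p' - t) q ≤ δ / 4) := by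
    intro k hk
    obtain ⟨a', ha', hac⟩ := hFD (φ k) c (by linarith)
    refine ⟨a', ha', hac, ?_⟩
    obtain ⟨i, hi⟩ := ha'
    have hi : x (Nk (φ k)) i - x (Nk (φ k)) (z (φ k)) = a' := hi
    have hwin_i : dist (x (Nk (φ k)) i) (x (Nk (φ k)) (z (φ k))) ≤ ((φ k : ℕ) : ℝ) + r₀ := by
      have h1 : dist (x (Nk (φ k)) i) (x (Nk (φ k)) (z (φ k))) = ‖a'‖ := by rw [dist_eq_norm, hi]
      have h2 : ‖a'‖ ≤ ‖c‖ + dist a' c := by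
        have := norm_le_norm_add_norm_sub' a' c
        rwa [← dist_eq_norm] at this
      rw [h1]; linarith
    have hnb := hzw (φ k) i hwin_i
    have hnFR : ¬ FR (Nk (φ k)) i := fun h => hnb (Or.inl h)
    simp only [hFR, not_not] at hnFR
    obtain ⟨t, ht1, ht2, hAPt⟩ := hnFR
    refine ⟨t, ht1, ht2, fun p' hp' hpa => ?_⟩
    obtain ⟨j, rfl⟩ := hp'
    have hji : dist (x (Nk (φ k)) j) (x (Nk (φ k)) i) ≤ 4 * b + 2 * r₀ + 3 := by
      have h1 : dist (x (Nk (φ k)) j - x (Nk (φ k)) (z (φ k))) a' = dist (x (Nk (φ k)) j) (x (Nk (φ k)) i) := by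
        rw [← hi, dist_sub_right]
      rwa [h1] at hpa
    obtain ⟨⟨l₁, hl₁⟩, ⟨l₂, hl₂⟩⟩ := hAPt j hji
    refine ⟨⟨x (Nk (φ k)) l₁ - x (Nk (φ k)) (z (φ k)), ⟨l₁, rfl⟩, ?_⟩,
      ⟨x (Nk (φ k)) l₂ - x (Nk (φ k)) (z (φ k)), ⟨l₂, rfl⟩, ?_⟩⟩
    · have h1 : dist (x (Nk (φ k)) j - x (Nk (φ k)) (z (φ k)) + t) (x (Nk (φ k)) l₁ - x (Nk (φ k)) (z (φ k))) =
          dist (x (Nk (φ k)) j + t) (x (Nk (φ k)) l₁) := by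
        rw [dist_eq_norm, dist_eq_norm]; congr 1; abel
      rw [h1]; exact hl₁
    · have h1 : dist (x (Nk (φ k)) j - x (Nk (φ k)) (z (φ k)) - t) (x (Nk (φ k)) l₂ - x (Nk (φ k)) (z (φ k))) =
          dist (x (Nk (φ k)) j - t) (x (Nk (φ k)) l₂) := by
        rw [dist_eq_norm, dist_eq_norm]; congr 1; abel
      rw [h1]; exact hl₂
  choose aW haW hacW tW htaW htbW hAPW using hloc
  -- Bolzano–Weierstrass for the local periods along the subsequence
  let sW : ℕ → EuclideanSpace ℝ (Fin 3) := fun k => if hk : ‖c‖ + r₀ ≤ ((φ k : ℕ) : ℝ) then tW k hk else 0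
  have hsmem : ∀ k, sW k ∈ closedBall (0 : EuclideanSpace ℝ (Fin 3)) (max b 0) := by
    intro k
    by_cases hk : ‖c‖ + r₀ ≤ ((φ k : ℕ) : ℝ)
    · simp only [sW, dif_pos hk, mem_closedBall_zero_iff]
      exact (htbW k hk).trans (le_max_left _ _)
    · simp only [sW, dif_neg hk, mem_closedBall, dist_self]
      exact le_max_right _ _
  obtain ⟨tinf, -, ψ, hψ, hlimt⟩ := tendsto_subseq_of_bounded
    (Metric.isBounded_closedBall : Bornology.IsBounded (closedBall (0 : EuclideanSpace ℝ (Fin 3)) (max b 0))) hsmem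
  have hwinE : ∀ᶠ j in atTop, ‖c‖ + r₀ ≤ ((φ (ψ j) : ℕ) : ℝ) := by
    obtain ⟨m₀, hm₀⟩ := exists_nat_ge (‖c‖ + r₀)
    filter_upwards [eventually_ge_atTop m₀] with j hj
    have h1 : (m₀ : ℝ) ≤ ((ψ j : ℕ) : ℝ) := by exact_mod_cast hj.trans (hψ.id_le j)
    exact hm₀.trans (h1.trans (hφge (ψ j)))
  have hta_inf : δ ≤ ‖tinf‖ := by
    refine ge_of_tendsto hlimt.norm ?_
    filter_upwards [hwinE] with j hj
    show δ ≤ ‖sW (ψ j)‖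
    simp only [sW, dif_pos hj]
    exact htaW _ _
  have htb_inf : ‖tinf‖ ≤ b := by
    refine le_of_tendsto hlimt.norm ?_
    filter_upwards [hwinE] with j hj
    show ‖sW (ψ j)‖ ≤ b
    simp only [sW, dif_pos hj]
    exact htbW _ _
  have hb0 : 0 ≤ b := (norm_nonneg _).trans htb_inf
  refine ⟨tinf, hta_inf, htb_inf, fun y hy hyc => ?_⟩
  have key : ∀ η : ℝ, 0 < η →
      (∃ y' ∈ Y, dist (y + tinf) y' ≤ δ / 4 + η) ∧ (∃ y' ∈ Y, dist (y - tinf) y' ≤ δ / 4 + η) := by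
    intro η hη
    set η₀ : ℝ := min η 1 with hη₀
    have hη₀pos : 0 < η₀ := lt_min hη one_pos
    have hη₀η : η₀ ≤ η := min_le_left _ _
    have hη₀1 : η₀ ≤ 1 := min_le_right _ _
    have e1 := hψ.tendsto_atTop.eventually (hmatch (‖c‖ + 4 * b + b + δ + 3) (η₀ / 4) (by positivity))
    have e3 : ∀ᶠ j in atTop, dist (sW (ψ j)) tinf ≤ η₀ / 4 :=
      (Metric.tendsto_nhds.1 hlimt (η₀ / 4) (by positivity)).mono fun j hj => hj.le
    obtain ⟨j, hk1, hk3, hkw⟩ := (e1.and (e3.and hwinE)).exists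
    have hsj : sW (ψ j) = tW (ψ j) hkw := by simp only [sW, dif_pos hkw]
    rw [hsj] at hk3
    have hyn : ‖y‖ ≤ ‖c‖ + 4 * b + b + δ + 3 := by
      have h1 : ‖y‖ ≤ ‖c‖ + dist y c := by
        have := norm_le_norm_add_norm_sub' y c
        rwa [← dist_eq_norm] at this
      linarith [hδ.le]
    obtain ⟨p, hp, hpy⟩ := hk1.1 y hy hyn
    have hpa : dist p (aW (ψ j) hkw) ≤ 4 * b + 2 * r₀ + 3 := by
      have h1 : dist p (aW (ψ j) hkw) ≤ dist p c + dist (aW (ψ j) hkw) c := dist_triangle_right _ _ _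
      have h2 : dist p c ≤ dist p y + dist y c := dist_triangle _ _ _
      have h3 := hacW (ψ j) hkw
      linarith
    have hpn : ‖p‖ ≤ ‖y‖ + η₀ / 4 := by
      have h1 : ‖p‖ ≤ ‖y‖ + dist p y := by
        have := norm_le_norm_add_norm_sub' p y
        rwa [← dist_eq_norm] at this
      linarith
    obtain ⟨⟨q₁, hq₁, hq₁d⟩, ⟨q₂, hq₂, hq₂d⟩⟩ := hAPW (ψ j) hkw p hp hpa
    have htk : ‖tW (ψ j) hkw‖ ≤ b := htbW _ _
    have hyc' : ‖y‖ ≤ ‖c‖ + 4 * b + 1 := by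
      have h1 : ‖y‖ ≤ ‖c‖ + dist y c := by
        have := norm_le_norm_add_norm_sub' y c
        rwa [← dist_eq_norm] at this
      linarith
    have hq₁n : ‖q₁‖ ≤ ‖c‖ + 4 * b + b + δ + 3 := by
      have h1 : ‖q₁‖ ≤ ‖p + tW (ψ j) hkw‖ + dist q₁ (p + tW (ψ j) hkw) := by
        have := norm_le_norm_add_norm_sub' q₁ (p + tW (ψ j) hkw)
        rwa [← dist_eq_norm] at this
      have h2 : ‖p + tW (ψ j) hkw‖ ≤ ‖p‖ + ‖tW (ψ j) hkw‖ := norm_add_le _ _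
      rw [dist_comm] at h1
      linarith [hδ.le]
    have hq₂n : ‖q₂‖ ≤ ‖c‖ + 4 * b + b + δ + 3 := by
      have h1 : ‖q₂‖ ≤ ‖p - tW (ψ j) hkw‖ + dist q₂ (p - tW (ψ j) hkw) := by
        have := norm_le_norm_add_norm_sub' q₂ (p - tW (ψ j) hkw)
        rwa [← dist_eq_norm] at this
      have h2 : ‖p - tW (ψ j) hkw‖ ≤ ‖p‖ + ‖tW (ψ j) hkw‖ := norm_sub_le _ _
      rw [dist_comm] at h1
      linarith [hδ.le]
    obtain ⟨y₁, hy₁, hqy₁⟩ := hk1.2 q₁ hq₁ hq₁n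
    obtain ⟨y₂, hy₂, hqy₂⟩ := hk1.2 q₂ hq₂ hq₂n
    refine ⟨⟨y₁, hy₁, ?_⟩, ⟨y₂, hy₂, ?_⟩⟩
    · calc dist (y + tinf) y₁
          ≤ dist (y + tinf) (p + tW (ψ j) hkw) + dist (p + tW (ψ j) hkw) y₁ := dist_triangle _ _ _
        _ ≤ (dist y p + dist tinf (tW (ψ j) hkw)) + (dist (p + tW (ψ j) hkw) q₁ + dist q₁ y₁) :=
            add_le_add (dist_add_add_le _ _ _ _) (dist_triangle _ _ _)
        _ ≤ (η₀ / 4 + η₀ / 4) + (δ / 4 + η₀ / 4) := by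
            gcongr
            · rwa [dist_comm] at hpy
            · rwa [dist_comm] at hk3
        _ ≤ δ / 4 + η := by linarith
    · calc dist (y - tinf) y₂
          ≤ dist (y - tinf) (p - tW (ψ j) hkw) + dist (p - tW (ψ j) hkw) y₂ := dist_triangle _ _ _
        _ ≤ (dist y p + dist tinf (tW (ψ j) hkw)) + (dist (p - tW (ψ j) hkw) q₂ + dist q₂ y₂) :=
            add_le_add (dist_sub_sub_le _ _ _ _) (dist_triangle _ _ _)
        _ ≤ (η₀ / 4 + η₀ / 4) + (δ / 4 + η₀ / 4) := by
            gcongr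
            · rwa [dist_comm] at hpy
            · rwa [dist_comm] at hk3
        _ ≤ δ / 4 + η := by linarith
  exact ⟨hattain (y + tinf) fun η hη => (key η hη).1, hattain (y - tinf) fun η hη => (key η hη).2⟩

/-- **The transfer, in the exact shape of the skeleton's stub `stub_sparse_of_costs`** (crux
`PeriodCoherenceLadder.MesoscopicCoarsePeriods`, line «frustration is paid for»): frustrated-sites cost (FSC) →
exposed-sites cost (= `SurfaceTensionNoFoam.ExposedSitesCost`) → energy per particle limit (= `SurfaceTensionNoFoam.CrysEnergyLimit`,
proved) → uniform separation `7/10` (landed) → along every sequence of ground states some Delone hull point has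
sparse (indeed: no) bad balls. -/
theorem sparse_of_costs :
    (∀ r₀ : ℝ, 0 < r₀ → ∃ δ b κ C : ℝ, 0 < δ ∧ δ ≤ 7 / 10 ∧ 0 < κ ∧ ∀ (N : ℕ) (y : Fin N → EuclideanSpace ℝ (Fin 3)), Literature.MathematicalPhysics.StatisticalMechanics.IsGroundState Literature.MathematicalPhysics.StatisticalMechanics.lennardJones y → κ * (Nat.card {i : Fin N // ¬ ∃ t : EuclideanSpace ℝ (Fin 3), δ ≤ ‖t‖ ∧ ‖t‖ ≤ b ∧ ∀ j : Fin N, dist (y j) (y i) ≤ 4 * b + 2 * r₀ + 3 → (∃ k : Fin N, dist (y j + t) (y k) ≤ δ / 4) ∧ (∃ k : Fin N, dist (y j - t) (y k) ≤ δ / 4)} : ℝ) ≤ (Literature.MathematicalPhysics.StatisticalMechanics.groundStateEnergy Literature.MathematicalPhysics.StatisticalMechanics.lennardJones 3 N - (N : ℝ) * (⨅ Q : Literature.MathematicalPhysics.StatisticalMechanics.PeriodicConfiguration 3, Q.energyPerParticle Literature.MathematicalPhysics.StatisticalMechanics.lennardJones)) + C * (Nat.card {i : Fin N // ∃ p : EuclideanSpace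 ℝ (Fin 3), dist p (y i) ≤ 4 * b + 2 * r₀ + 4 ∧ ∀ j : Fin N, r₀ ≤ dist p (y j)} : ℝ)) → (∃ r₀ : ℝ, 0 < r₀ ∧ ∀ R : ℝ, 0 < R → ∃ c : ℝ, 0 < c ∧ ∀ (N : ℕ) (x : Fin N → EuclideanSpace ℝ (Fin 3)), Literature.MathematicalPhysics.StatisticalMechanics.IsGroundState Literature.MathematicalPhysics.StatisticalMechanics.lennardJones x → c * (Nat.card {i : Fin N // ∃ p : EuclideanSpace ℝ (Fin 3), dist p (x i) ≤ R ∧ ∀ j : Fin N, r₀ ≤ dist p (x j)} : ℝ) ≤ Literature.MathematicalPhysics.StatisticalMechanics.groundStateEnergy Literature.MathematicalPhysics.StatisticalMechanics.lennardJones 3 N - (N : ℝ) * (⨅ Q : Literature.MathematicalPhysics.StatisticalMechanics.PeriodicConfiguration 3, Q.energyPerParticle Literature.MathematicalPhysics.StatisticalMechanics.lennardJones)) → (Filter.Tendsto (fun N : ℕ => Literature.MathematicalPhysics.StatisticalMechanics.groundStateEnergy Literature.MathematicalPhysics.StatisticalMechanics.lennardJones 3 N / N) Filter.atTop (nhds (⨅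 Q : Literature.MathematicalPhysics.StatisticalMechanics.PeriodicConfiguration 3, Q.energyPerParticle Literature.MathematicalPhysics.StatisticalMechanics.lennardJones))) → (∀ (N : ℕ) (y : Fin N → EuclideanSpace ℝ (Fin 3)), Literature.MathematicalPhysics.StatisticalMechanics.IsGroundState Literature.MathematicalPhysics.StatisticalMechanics.lennardJones y → ∀ i j : Fin N, i ≠ j → (7 : ℝ) / 10 ≤ dist (y i) (y j)) → ∀ x : (N : ℕ) → (Fin N → EuclideanSpace ℝ (Fin 3)), (∀ N, Literature.MathematicalPhysics.StatisticalMechanics.IsGroundState Literature.MathematicalPhysics.StatisticalMechanics.lennardJones (x N)) → (∃ X : Set (EuclideanSpace ℝ (Fin 3)), ((∃ δ : ℝ, 0 < δ ∧ ∀ p ∈ X, ∀ q ∈ X, p ≠ q → δ ≤ dist p q) ∧ (∃ r : ℝ, ∀ c : EuclideanSpace ℝ (Fin 3), ∃ p ∈ X, dist p c ≤ r)) ∧ (∀ R ε : ℝ, 0 < ε → ∃ᶠ N in Filter.atTop, ∃ t : EuclideanSpace ℝ (Fin 3), (∀ p ∈ X, ‖p‖ ≤ R → ∃ i : Fin N,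 dist (x N i + t) p ≤ ε) ∧ (∀ i : Fin N, ‖x N i + t‖ ≤ R → ∃ p ∈ X, dist (x N i + t) p ≤ ε))) → ∃ δ r b : ℝ, 0 < δ ∧ ∃ X : Set (EuclideanSpace ℝ (Fin 3)), (∀ p ∈ X, ∀ q ∈ X, p ≠ q → δ ≤ dist p q) ∧ (∀ c : EuclideanSpace ℝ (Fin 3), ∃ p ∈ X, dist p c ≤ r) ∧ (∀ R ε : ℝ, 0 < ε → ∃ᶠ N in Filter.atTop, ∃ t : EuclideanSpace ℝ (Fin 3), (∀ p ∈ X, ‖p‖ ≤ R → ∃ i : Fin N, dist (x N i + t) p ≤ ε) ∧ (∀ i : Fin N, ‖x N i + t‖ ≤ R → ∃ p ∈ X, dist (x N i + t) p ≤ ε)) ∧ ∀ ε : ℝ, 0 < ε → ∃ L₀ : ℝ, ∀ L : ℝ, L₀ ≤ L → ∀ F : Finset (EuclideanSpace ℝ (Fin 3)), (∀ c ∈ F, ‖c‖ ≤ L) → (∀ c ∈ F, ¬ ∃ t : EuclideanSpace ℝ (Fin 3), δ ≤ ‖t‖ ∧ ‖t‖ ≤ b ∧ ∀ p ∈ X,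 dist p c ≤ 4 * b + 1 → (∃ q ∈ X, dist (p + t) q ≤ δ / 4) ∧ (∃ q ∈ X, dist (p - t) q ≤ δ / 4)) → (∀ c ∈ F, ∀ c' ∈ F, c ≠ c' → 8 * b + 2 < dist c c') → (F.card : ℝ) ≤ ε * L ^ 3 := by
  intro hFSC hESC hCEL hSEP x hx _h0
  obtain ⟨r₀, hr₀, hESC'⟩ := hESC
  obtain ⟨δ, b, κ, C, hδ, hδ7, hκ, hF⟩ := hFSC r₀ hr₀
  have hR'pos : 0 < max (4 * b + 2 * r₀ + 4) (r₀ + 1) := lt_of_lt_of_le (by linarith) (le_max_right _ _)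
  obtain ⟨c₀, hc₀, hE⟩ := hESC' (max (4 * b + 2 * r₀ + 4) (r₀ + 1)) hR'pos
  obtain ⟨X, hXsep, hXden, hXhull, hgood⟩ := noBadBalls_of_costs x
    (fun N i j hij => hSEP N (x N) (hx N) i j hij)
    (fun N => Literature.MathematicalPhysics.StatisticalMechanics.groundStateEnergy Literature.MathematicalPhysics.StatisticalMechanics.lennardJones 3 N - (N : ℝ) * (⨅ Q : Literature.MathematicalPhysics.StatisticalMechanics.PeriodicConfiguration 3, Q.energyPerParticle Literature.MathematicalPhysics.StatisticalMechanics.lennardJones))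
    (tendsto_excess_div _ _ hCEL)
    r₀ δ b κ C c₀ (max (4 * b + 2 * r₀ + 4) (r₀ + 1)) hr₀ hδ hδ7 hκ hc₀ (le_max_left _ _)
    (by linarith [le_max_right (4 * b + 2 * r₀ + 4) (r₀ + 1)])
    (fun N => hF N (x N) (hx N)) (fun N => hE N (x N) (hx N))
  refine ⟨δ, r₀ + 1, b, hδ, X, hXsep, hXden, hXhull, fun ε hε => ⟨0, fun L hL F _ hbad _ => ?_⟩⟩
  have hF0 : F = ∅ := Finset.eq_empty_of_forall_notMem fun c hc => hbad c hc (hgood c)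
  rw [hF0, Finset.card_empty, Nat.cast_zero]
  exact mul_nonneg hε.le (pow_nonneg hL 3)

/-- **The residual crux from the two cost statements** (plus the two landed facts, kept as hypotheses to stay
inside the route's import cone): `MesoscopicCoarsePeriods` follows from FSC, `ExposedSitesCost`,
`CrysEnergyLimit` (`SurfaceTensionNoFoam.CrysEnergyLimit_holds`) and the uniform separation `7/10`
(`Theorems.LjLaminarWindowsSketch.lennardJones_groundState_dist_ge_seven_tenths`), through
`…CleanWindows.mesoscopicCoarsePeriods_of_badBallsSparse`. -/
theorem mesoscopicCoarsePeriods_of_costs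
    (hFSC : ∀ r₀ : ℝ, 0 < r₀ → ∃ δ b κ C : ℝ, 0 < δ ∧ δ ≤ 7 / 10 ∧ 0 < κ ∧ ∀ (N : ℕ) (y : Fin N → EuclideanSpace ℝ (Fin 3)), Literature.MathematicalPhysics.StatisticalMechanics.IsGroundState Literature.MathematicalPhysics.StatisticalMechanics.lennardJones y → κ * (Nat.card {i : Fin N // ¬ ∃ t : EuclideanSpace ℝ (Fin 3), δ ≤ ‖t‖ ∧ ‖t‖ ≤ b ∧ ∀ j : Fin N, dist (y j) (y i) ≤ 4 * b + 2 * r₀ + 3 → (∃ k : Fin N, dist (y j + t) (y k) ≤ δ / 4) ∧ (∃ k : Fin N, dist (y j - t) (y k) ≤ δ / 4)} : ℝ) ≤ (Literature.MathematicalPhysics.StatisticalMechanics.groundStateEnergy Literature.MathematicalPhysics.StatisticalMechanics.lennardJones 3 N - (N : ℝ) * (⨅ Q : Literature.MathematicalPhysics.StatisticalMechanics.PeriodicConfiguration 3, Q.energyPerParticle Literature.MathematicalPhysics.StatisticalMechanics.lennardJones)) + C * (Nat.card {i : Fin N // ∃ p : EuclideanSpace ℝ (Fin 3), dist p (y i)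 ≤ 4 * b + 2 * r₀ + 4 ∧ ∀ j : Fin N, r₀ ≤ dist p (y j)} : ℝ))
    (hESC : ∃ r₀ : ℝ, 0 < r₀ ∧ ∀ R : ℝ, 0 < R → ∃ c : ℝ, 0 < c ∧ ∀ (N : ℕ) (x : Fin N → EuclideanSpace ℝ (Fin 3)), Literature.MathematicalPhysics.StatisticalMechanics.IsGroundState Literature.MathematicalPhysics.StatisticalMechanics.lennardJones x → c * (Nat.card {i : Fin N // ∃ p : EuclideanSpace ℝ (Fin 3), dist p (x i) ≤ R ∧ ∀ j : Fin N, r₀ ≤ dist p (x j)} : ℝ) ≤ Literature.MathematicalPhysics.StatisticalMechanics.groundStateEnergy Literature.MathematicalPhysics.StatisticalMechanics.lennardJones 3 N - (N : ℝ) * (⨅ Q : Literature.MathematicalPhysics.StatisticalMechanics.PeriodicConfiguration 3, Q.energyPerParticle Literature.MathematicalPhysics.StatisticalMechanics.lennardJones))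
    (hCEL : Filter.Tendsto (fun N : ℕ => Literature.MathematicalPhysics.StatisticalMechanics.groundStateEnergy Literature.MathematicalPhysics.StatisticalMechanics.lennardJones 3 N / N) Filter.atTop (nhds (⨅ Q : Literature.MathematicalPhysics.StatisticalMechanics.PeriodicConfiguration 3, Q.energyPerParticle Literature.MathematicalPhysics.StatisticalMechanics.lennardJones)))
    (hSEP : ∀ (N : ℕ) (y : Fin N → EuclideanSpace ℝ (Fin 3)), Literature.MathematicalPhysics.StatisticalMechanics.IsGroundState Literature.MathematicalPhysics.StatisticalMechanics.lennardJones y → ∀ i j : Fin N, i ≠ j → (7 : ℝ) / 10 ≤ dist (y i) (y j)) :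
    Summit.AtomisticToContinuum.Crystallization.Theses.PeriodCoherenceLadder.MesoscopicCoarsePeriods :=
  PeriodCoherenceLadderCleanWindows.mesoscopicCoarsePeriods_of_badBallsSparse (sparse_of_costs hFSC hESC hCEL hSEP)

end PeriodCoherenceLadderSparseTransfer

end Summit.AtomisticToContinuum.Crystallization.Theorems

end
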